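import Summits.BirchSwinnertonDyer.BirchSwinnertonDyer.Theorems.UniversalToricDescentThinCombRigidity
import Summits.BirchSwinnertonDyer.BirchSwinnertonDyer.Theorems.UniversalToricDescentThinCombTransport
import HarnessLib

/-!
# Sketch (planner `bsd-wall-utd-idea` g43) — GRID DENSITY for the wall `AdditiveSplitIMCInclusionAtThree`
# (item stmt-BirchSwinnertonDyer-20395), line `thin_comb` v2, research stub `stub_twoVarCombSupply` (K2⁺ ⊕ K3 ⊕ K4)

EVIDENCE ONLY (cell `pub/bsd-wall`); nothing here is a route item, nothing about elliptic curves is asserted, BSD is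
not proved by any of this.

THE GAP THIS FILE CLOSES. Every "pointwise at deep characters ⇒ `Λ₂`-identity" step of the line (the typing device
D1 for the two-variable `L`-function K3, the stable-fibre regulator of g42, the deep-conductor-stability card of g28)
ends with a DENSITY statement: an element of `Λ₂(𝒪) = 𝒪⟦T₂⟧⟦T₁⟧` that vanishes at all pairs of `p`-power torsion
points `(T₁, T₂) = (ζ − 1, ζ' − 1)` of UNBOUNDED orders is `0`. The g42 one-variable lemma
(`eq_zero_of_torsionCombDvdRat`, Sketch-utd-idea-g42.lean) needs the coefficient ring to be a DVR with maximal ideal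
`(p)`; but after restricting to a comb line `T₂ = ζ_{p^{m+1}} − 1` the coefficient ring is the LEVEL RING
`𝒪_m = 𝒪⟦X⟧/(E_m) ≅ 𝒪[ζ_{p^{m+1}}]`, which is RAMIFIED (`p ∼ ϖ_m^{φ(p^{m+1})}`), so that lemma does not apply on
the line. This file proves the one-variable torsion density over ANY coefficient ring with a regular prime `ϖ`,
`p ∈ (ϖ)` and `⋂ (ϖ^k) = 0` (§2), instantiates it on the level rings (§3, separatedness by Krull's intersection
theorem — no Weierstrass preparation, no completeness), and deduces the GRID DENSITY in `Λ₂(𝒪)` (§4):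
`F ∈ (E_m(T₂), E_n(T₁))` for `m` of unbounded order and, for each such `m`, `n` of unbounded order ⇒ `F = 0`
(reduction to the lead's `eq_zero_of_thinCombDvdRat_zero`). §5: instances `ℤ_p` and `R₀ = unrIntegers p`.

DICTIONARY. `E_m(X) = Φ_{p^{m+1}}(1+X)` (`combSeries`), `E_m(T₂) = combElt`, `E_n(T₁) = combSeries (PowerSeries 𝒪) p n`
(the outer variable); membership in `(E_m(T₂), E_n(T₁))` = vanishing at all `Gal`-conjugates of the grid point
`(ζ_{p^{n+1}} − 1, ζ_{p^{m+1}} − 1)`, i.e. at a pair of anticyclotomic characters of `𝔭`- and `𝔭'`-conductor exponents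
`n+1`, `m+1` — exactly the DEEP points (both exponents large) at which the sharpening S-g43-1 proposes to type D1.

CONTENTS (kernel-checked, no `sorry`):
* §1 `map_combSeries` — naturality of the levels under ring maps;
* §2 `CombDvdOfLevels`, `eq_zero_of_combDvdOfLevels` — torsion density over a general coefficient ring;
* §3 `levelRing_eq_zero_of_forall_pow_dvd` (Krull separatedness of `𝒪_m`), `eq_zero_of_combDvdOfLevels_levelRing`;
* §4 `GridMem`, `map_level_eq_zero_of_grid`, `eq_zero_of_gridMem`, `eq_of_gridMem_sub`;
* §5 `eq_of_gridMem_sub_padicInt`, `eq_of_gridMem_sub_unrIntegers`.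

References: Washington, *Introduction to Cyclotomic Fields*, Lemma 1.4, §7.1–§7.2 [cite: Washington1997, §7.1–§7.2];
Matsumura, *Commutative Ring Theory*, Thm. 8.10 (Krull intersection theorem) [cite: Matsumura1987, Thm. 8.10].
-/

set_option linter.dupNamespace false

noncomputable section

namespace Summit.BirchSwinnertonDyer.BirchSwinnertonDyer.Cruxes.AdditiveSplitIMCInclusionAtThree.DeepGrid

open Summit.BirchSwinnertonDyer.BirchSwinnertonDyer.Theorems.UniversalToricDescentThinComb
open Polynomial

/-! ## §1 Naturality of the comb levels -/

section Naturality

variable {R S : Type*} [CommRing R] [CommRing S] (p n : ℕ)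

/-- `E_n` has integer coefficients, so it is preserved by every ring map of coefficients.
[cite: Washington1997, §7.1] -/
theorem map_combSeries (f : R →+* S) :
    PowerSeries.map f (combSeries R p n) = combSeries S p n := by
  ext j
  simp [PowerSeries.coeff_map, coeff_combSeries]

end Naturality

/-! ## §2 One-variable torsion density over a general coefficient ring -/

section TorsionDensity

variable {A : Type*} [CommRing A] (p : ℕ) [hp : Fact p.Prime]

/-- **Comb divisibility on levels of unbounded order** in `A⟦X⟧`: for every `N` some `E_n`, `n ≥ N`, divides `H`
("`H` vanishes at the primitive `p^{n+1}`-torsion points `ζ − 1` for unboundedly many `n`").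
[cite: Washington1997, §7.1] -/
def CombDvdOfLevels (H : PowerSeries A) : Prop :=
  ∀ N : ℕ, ∃ n : ℕ, N ≤ n ∧ combSeries A p n ∣ H

variable {p}

omit hp in
/-- Cancellation of a regular constant. [folklore] -/
theorem C_mul_left_cancel {ϖ : A} (hreg : ∀ z : A, ϖ * z = 0 → z = 0) {U V : PowerSeries A}
    (h : PowerSeries.C ϖ * U = PowerSeries.C ϖ * V) : U = V := by
  ext j
  have hj := congrArg (PowerSeries.coeff j) h
  simp only [PowerSeries.coeff_C_mul] at hj
  have h0 : ϖ * (PowerSeries.coeff j U - PowerSeries.coeff j V) = 0 := by rw [mul_sub, hj, sub_self]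
  exact sub_eq_zero.mp (hreg _ h0)

/-- Modulo an ideal containing `p`, the level `E_n` becomes `X^{deg E_n}`. [cite: Washington1997, Lemma 1.4] -/
theorem map_combSeries_eq_X_pow_of_mem {ϖ : A} (hpϖ : (p : A) ∈ Ideal.span {ϖ}) (n : ℕ) :
    PowerSeries.map (Ideal.Quotient.mk (Ideal.span {ϖ})) (combSeries A p n) =
      PowerSeries.X ^ (combPoly p n).natDegree := by
  rw [map_combSeries]
  obtain ⟨w, -, hw⟩ := combSeries_eq_X_pow_add (A ⧸ Ideal.span {ϖ}) p n
  have h0 : ((p : ℕ) : A ⧸ Ideal.span {ϖ}) = 0 := by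
    rw [← map_natCast (Ideal.Quotient.mk (Ideal.span {ϖ})), Ideal.Quotient.eq_zero_iff_mem]
    exact hpϖ
  rw [hw, h0, map_zero, zero_mul, add_zero]

/-- Step 1 of the density induction: all coefficients of `H` lie in `(ϖ)`. Reduce modulo `ϖ`: `X^{deg E_n} ∣ H̄`
for `deg E_n > n` unbounded. [cite: Washington1997, §7.1] -/
theorem dvd_coeff_of_combDvdOfLevels {ϖ : A} (hpϖ : (p : A) ∈ Ideal.span {ϖ})
    {H : PowerSeries A} (hH : CombDvdOfLevels p H) (j : ℕ) : ϖ ∣ PowerSeries.coeff j H := by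
  obtain ⟨n, hn, q, hq⟩ := hH j
  have hdvd : PowerSeries.X ^ (combPoly p n).natDegree ∣
      PowerSeries.map (Ideal.Quotient.mk (Ideal.span {ϖ})) H :=
    ⟨PowerSeries.map (Ideal.Quotient.mk (Ideal.span {ϖ})) q, by
      rw [← map_combSeries_eq_X_pow_of_mem hpϖ, ← map_mul, ← hq]⟩
  have hlt : j < (combPoly p n).natDegree := lt_of_le_of_lt hn (lt_natDegree_combPoly p n)
  have h0 := (PowerSeries.X_pow_dvd_iff.mp hdvd) j hlt
  rw [PowerSeries.coeff_map, Ideal.Quotient.eq_zero_iff_mem, Ideal.mem_span_singleton] at h0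
  exact h0

/-- Step 2 of the density induction: if `E_n ∣ ϖ·H'` on unboundedly many levels then `E_n ∣ H'` there, because
`C ϖ` is prime in `A⟦X⟧` and does not divide any `E_n` (its reduction is `X^{deg E_n} ≠ 0`).
[cite: Washington1997, §7.1] -/
theorem combDvdOfLevels_of_C_mul {ϖ : A} (hϖ : Prime ϖ) (hreg : ∀ z : A, ϖ * z = 0 → z = 0)
    (hpϖ : (p : A) ∈ Ideal.span {ϖ}) {H' : PowerSeries A}
    (hH : CombDvdOfLevels p (PowerSeries.C ϖ * H')) : CombDvdOfLevels p H' := by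
  intro N
  obtain ⟨n, hn, q, hq⟩ := hH N
  refine ⟨n, hn, ?_⟩
  have hC : Prime (PowerSeries.C ϖ : PowerSeries A) :=
    Literature.NumberTheory.EllipticCurves.prime_C_of_prime hϖ
  have h1 : PowerSeries.C ϖ ∣ combSeries A p n * q := ⟨H', hq.symm⟩
  rcases hC.dvd_or_dvd h1 with hE | hq'
  · exfalso
    obtain ⟨r, hr⟩ := hE
    haveI : (Ideal.span {ϖ}).IsPrime := (Ideal.span_singleton_prime hϖ.ne_zero).mpr hϖ
    have h2 := congrArg (PowerSeries.map (Ideal.Quotient.mk (Ideal.span {ϖ}))) hr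
    rw [map_combSeries_eq_X_pow_of_mem hpϖ, map_mul, PowerSeries.map_C,
      (Ideal.Quotient.eq_zero_iff_mem).mpr (Ideal.mem_span_singleton_self ϖ), map_zero, zero_mul] at h2
    exact pow_ne_zero _ PowerSeries.X_ne_zero h2
  · obtain ⟨q', rfl⟩ := hq'
    refine ⟨q', C_mul_left_cancel hreg ?_⟩
    rw [hq]; ring

/-- **Torsion density over a general coefficient ring.** Let `ϖ ∈ A` be a regular prime element with `p ∈ (ϖ)`
and `⋂_k (ϖ^k) = 0`. If `E_n ∣ H` in `A⟦X⟧` for `n` of unbounded order, then `H = 0`. (Induction: Step 1 gives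
`H = ϖ·H'`, Step 2 gives the hypothesis for `H'`; so every coefficient lies in `⋂_k (ϖ^k)`.) The case of interest
is the RAMIFIED level ring `A = 𝒪[ζ_{p^{m+1}}]`, `ϖ = ζ − 1` (§3). [cite: Washington1997, §7.1–§7.2] -/
theorem eq_zero_of_combDvdOfLevels {ϖ : A} (hϖ : Prime ϖ) (hreg : ∀ z : A, ϖ * z = 0 → z = 0)
    (hpϖ : (p : A) ∈ Ideal.span {ϖ}) (hsep : ∀ z : A, (∀ k : ℕ, ϖ ^ k ∣ z) → z = 0)
    {H : PowerSeries A} (hH : CombDvdOfLevels p H) : H = 0 := by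
  suffices key : ∀ (k : ℕ) (G : PowerSeries A), CombDvdOfLevels p G →
      ∀ j : ℕ, ϖ ^ k ∣ PowerSeries.coeff j G by
    ext j
    rw [map_zero]
    exact hsep _ (fun k => key k H hH j)
  intro k
  induction k with
  | zero => intro G _ j; exact ⟨PowerSeries.coeff j G, by rw [pow_zero, one_mul]⟩
  | succ k ih =>
    intro G hG j
    choose c hc using fun i => exists_eq_mul_right_of_dvd (dvd_coeff_of_combDvdOfLevels hpϖ hG i)
    have hG' : G = PowerSeries.C ϖ * PowerSeries.mk c := by
      ext i
      rw [PowerSeries.coeff_C_mul, PowerSeries.coeff_mk, hc]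
    have hlev : CombDvdOfLevels p (PowerSeries.mk c) :=
      combDvdOfLevels_of_C_mul hϖ hreg hpϖ (hG' ▸ hG)
    obtain ⟨d, hd⟩ := ih (PowerSeries.mk c) hlev j
    rw [PowerSeries.coeff_mk] at hd
    exact ⟨d, by rw [hc, hd, pow_succ]; ring⟩

end TorsionDensity

/-! ## §3 The level rings `𝒪_m = 𝒪⟦X⟧/(E_m)`: separatedness (Krull) and torsion density -/

section LevelRingDensity

variable (𝒪 : Type*) [CommRing 𝒪] [IsDomain 𝒪] [IsDiscreteValuationRing 𝒪] (p m : ℕ) [hp : Fact p.Prime]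

/-- **`⋂_k p^k 𝒪_m = 0`.** The level ring is a Noetherian local ring (quotient of `𝒪⟦X⟧`) in which `p` is not a
unit (it maps to `0` in the residue ring `𝒪/(p) ≠ 0`), so Krull's intersection theorem applies. No completeness of
`𝒪` is used. [cite: Matsumura1987, Thm. 8.10; Washington1997, Prop. 7.2] -/
theorem levelRing_eq_zero_of_forall_natCast_pow_dvd (hmax : IsLocalRing.maximalIdeal 𝒪 = Ideal.span {(p : 𝒪)})
    (z : LevelRing 𝒪 p m) (hz : ∀ k : ℕ, (p : LevelRing 𝒪 p m) ^ k ∣ z) : z = 0 := by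
  obtain ⟨hp0, hpu, hprime, hpprime⟩ := p_ne_zero_of_maximalIdeal_eq 𝒪 p hmax
  obtain ⟨σ, -, hσcomp, -⟩ := exists_levelRing_to_residue 𝒪 p m
  haveI : Nontrivial (𝒪 ⧸ Ideal.span {(p : 𝒪)}) :=
    Ideal.Quotient.nontrivial_iff.mpr (by rw [Ne, Ideal.span_singleton_eq_top]; exact hpu)
  haveI : Nontrivial (LevelRing 𝒪 p m) := σ.domain_nontrivial
  haveI : IsLocalRing (LevelRing 𝒪 p m) :=
    IsLocalRing.of_surjective' (Ideal.Quotient.mk (Ideal.span {combSeries 𝒪 p m})) Ideal.Quotient.mk_surjective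
  have hσp : σ (p : LevelRing 𝒪 p m) = 0 := by
    have h1 : (p : LevelRing 𝒪 p m) =
        Ideal.Quotient.mk (Ideal.span {combSeries 𝒪 p m}) (PowerSeries.C (p : 𝒪)) := by
      rw [map_natCast (PowerSeries.C (R := 𝒪)) p, map_natCast]
    rw [h1, ← RingHom.comp_apply, hσcomp, RingHom.comp_apply, PowerSeries.constantCoeff_C,
      Ideal.Quotient.eq_zero_iff_mem]
    exact Ideal.mem_span_singleton_self _
  have hne : Ideal.span {(p : LevelRing 𝒪 p m)} ≠ ⊤ := by
    rw [Ne, Ideal.span_singleton_eq_top]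
    intro hu
    exact (hu.map σ).ne_zero hσp
  have hK := Ideal.iInf_pow_eq_bot_of_isLocalRing (Ideal.span {(p : LevelRing 𝒪 p m)}) hne
  have hzmem : z ∈ ⨅ i : ℕ, Ideal.span {(p : LevelRing 𝒪 p m)} ^ i := by
    rw [Ideal.mem_iInf]
    intro i
    rw [Ideal.span_singleton_pow, Ideal.mem_span_singleton]
    exact hz i
  rw [hK] at hzmem
  exact (Ideal.mem_bot).mp hzmem

/-- `⋂_k (ϖ_m^k) = 0` in the level ring, `ϖ_m` = the class of `X` (from `p ∼ ϖ_m^{deg E_m}` and the previous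
lemma). [cite: Washington1997, Lemma 1.4 and Prop. 7.2] -/
theorem levelRing_eq_zero_of_forall_varpi_pow_dvd (hmax : IsLocalRing.maximalIdeal 𝒪 = Ideal.span {(p : 𝒪)})
    (z : LevelRing 𝒪 p m)
    (hz : ∀ k : ℕ, (Ideal.Quotient.mk (Ideal.span {combSeries 𝒪 p m}) PowerSeries.X) ^ k ∣ z) : z = 0 := by
  refine levelRing_eq_zero_of_forall_natCast_pow_dvd 𝒪 p m hmax z fun k => ?_
  obtain ⟨u, hu⟩ := exists_natCast_p_eq_varpi_pow_mul 𝒪 p m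
  rw [hu, mul_pow, IsUnit.mul_right_dvd (u.isUnit.pow k), ← pow_mul]
  exact hz _

/-- **Torsion density on a comb line.** Over the (ramified) level ring `𝒪_m`, a power series divisible by `E_n(T₁)`
for `n` of unbounded order is `0`: §2 with `ϖ = ϖ_m` (prime and regular by Part II of the lead's files, `p ∈ (ϖ_m)`,
separated by Krull). [cite: Washington1997, §7.1–§7.2; Matsumura1987, Thm. 8.10] -/
theorem eq_zero_of_combDvdOfLevels_levelRing (hmax : IsLocalRing.maximalIdeal 𝒪 = Ideal.span {(p : 𝒪)})
    {H : PowerSeries (LevelRing 𝒪 p m)} (hH : CombDvdOfLevels p H) : H = 0 := by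
  obtain ⟨hp0, hpu, hprime, hpprime⟩ := p_ne_zero_of_maximalIdeal_eq 𝒪 p hmax
  haveI := hprime
  refine eq_zero_of_combDvdOfLevels (varpi_prime 𝒪 p m hp0)
    (fun z hz => varpi_mul_eq_zero_imp 𝒪 p m hp0 hz) ?_
    (fun z hz => levelRing_eq_zero_of_forall_varpi_pow_dvd 𝒪 p m hmax z hz) hH
  exact Ideal.span_singleton_le_span_singleton.mpr
    (dvd_pow_self _ (natDegree_combPoly_pos p m).ne') (natCast_p_mem_span_varpi_pow 𝒪 p m)

end LevelRingDensity

/-! ## §4 Grid density in `Λ₂(𝒪) = 𝒪⟦T₂⟧⟦T₁⟧` -/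

section Grid

variable (𝒪 : Type*) [CommRing 𝒪] [IsDomain 𝒪] [IsDiscreteValuationRing 𝒪] (p : ℕ) [hp : Fact p.Prime]

/-- **Grid membership.** `F ∈ Λ₂(𝒪)` lies in `(E_m(T₂), E_n(T₁))` for levels `m` of unbounded order and, for each
such `m`, levels `n` of unbounded order — i.e. `F` vanishes at all pairs of primitive `p`-power torsion points
`(T₁, T₂) = (ζ − 1, ζ' − 1)` of a product-unbounded GRID (and their conjugates). In the wall's dictionary
(`1 + T₁ = γ_𝔭`, `1 + T₂ = γ_𝔭'`): at all sufficiently DEEP pairs of anticyclotomic conductor exponents.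
[cite: Washington1997, §7.1] -/
def GridMem (F : PowerSeries (PowerSeries 𝒪)) : Prop :=
  ∀ N : ℕ, ∃ m : ℕ, N ≤ m ∧ ∀ N' : ℕ, ∃ n : ℕ, N' ≤ n ∧
    F ∈ Ideal.span {combElt 𝒪 p m, combSeries (PowerSeries 𝒪) p n}

/-- On ONE comb line `T₂ = ζ_{p^{m+1}} − 1` (reduction of inner coefficients modulo `E_m`): vanishing at `E_n(T₁) = 0`
for `n` unbounded forces the restriction `F|_{line} ∈ 𝒪_m⟦T₁⟧` to vanish. [cite: Washington1997, §7.1–§7.2] -/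
theorem map_level_eq_zero_of_grid (hmax : IsLocalRing.maximalIdeal 𝒪 = Ideal.span {(p : 𝒪)})
    {F : PowerSeries (PowerSeries 𝒪)} (m : ℕ)
    (h : ∀ N' : ℕ, ∃ n : ℕ, N' ≤ n ∧ F ∈ Ideal.span {combElt 𝒪 p m, combSeries (PowerSeries 𝒪) p n}) :
    PowerSeries.map (Ideal.Quotient.mk (Ideal.span {combSeries 𝒪 p m})) F = 0 := by
  refine eq_zero_of_combDvdOfLevels_levelRing 𝒪 p m hmax fun N' => ?_
  obtain ⟨n, hn, hmem⟩ := h N'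
  refine ⟨n, hn, ?_⟩
  obtain ⟨a, b, hab⟩ := Ideal.mem_span_pair.mp hmem
  have hE : PowerSeries.map (Ideal.Quotient.mk (Ideal.span {combSeries 𝒪 p m})) (combElt 𝒪 p m) = 0 := by
    rw [combElt, PowerSeries.map_C, (Ideal.Quotient.eq_zero_iff_mem).mpr (Ideal.mem_span_singleton_self _),
      map_zero]
  refine ⟨PowerSeries.map (Ideal.Quotient.mk (Ideal.span {combSeries 𝒪 p m})) b, ?_⟩
  have h2 := congrArg (PowerSeries.map (Ideal.Quotient.mk (Ideal.span {combSeries 𝒪 p m}))) hab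
  rw [map_add, map_mul, map_mul, hE, mul_zero, zero_add, map_combSeries] at h2
  rw [← h2, mul_comm]

/-- **GRID DENSITY.** An element of `Λ₂(𝒪)` vanishing on a product-unbounded grid of torsion points is `0`
(`𝒪` a DVR with maximal ideal `(p)`): each deep comb line carries the zero restriction (previous lemma), i.e.
`F ∈ (E_m(T₂))` for `m` unbounded, and the lead's `eq_zero_of_thinCombDvdRat_zero` (with `G = 0`, no slack)
concludes. This is the two-variable density that turns an interpolation property at DEEP character pairs into an
identity in `Λ₂` (uniqueness half of D1; K3 (i)/(ii) as corollaries). [cite: Washington1997, §7.1–§7.2] -/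
theorem eq_zero_of_gridMem (hmax : IsLocalRing.maximalIdeal 𝒪 = Ideal.span {(p : 𝒪)})
    {F : PowerSeries (PowerSeries 𝒪)} (h : GridMem 𝒪 p F) : F = 0 := by
  refine eq_zero_of_thinCombDvdRat_zero 𝒪 p hmax fun N => ?_
  obtain ⟨m, hm, hgrid⟩ := h N
  refine ⟨m, hm, 0, ?_⟩
  rw [pow_zero, map_one, one_mul, mem_span_combElt_iff_map_dvd, map_zero,
    map_level_eq_zero_of_grid 𝒪 p hmax m hgrid]

/-- **Uniqueness on the grid**: two elements of `Λ₂(𝒪)` congruent modulo `(E_m(T₂), E_n(T₁))` on a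
product-unbounded grid are EQUAL. [cite: Washington1997, §7.1–§7.2] -/
theorem eq_of_gridMem_sub (hmax : IsLocalRing.maximalIdeal 𝒪 = Ideal.span {(p : 𝒪)})
    {F G : PowerSeries (PowerSeries 𝒪)} (h : GridMem 𝒪 p (F - G)) : F = G :=
  sub_eq_zero.mp (eq_zero_of_gridMem 𝒪 p hmax h)

end Grid

/-! ## §5 Instances: `ℤ_p` and `R₀ = unrIntegers p` -/

section Instances

variable (p : ℕ) [hp : Fact p.Prime]

/-- `ℤ_p` instance of grid density. [cite: Washington1997, §7.1–§7.2] -/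
theorem eq_of_gridMem_sub_padicInt {F G : PowerSeries (PowerSeries ℤ_[p])} (h : GridMem ℤ_[p] p (F - G)) :
    F = G :=
  eq_of_gridMem_sub ℤ_[p] p PadicInt.maximalIdeal_eq_span_p h

/-- `R₀ = unrIntegers p` instance of grid density (coefficients of the wall's receptacle `UnrSeries p`; the
two-variable receptacle of D1 is `R₀⟦T₂⟧⟦T₁⟧`). [cite: Washington1997, §7.1–§7.2] -/
theorem eq_of_gridMem_sub_unrIntegers
    {F G : PowerSeries (PowerSeries (Literature.NumberTheory.EllipticCurves.unrIntegers p))}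
    (h : GridMem (Literature.NumberTheory.EllipticCurves.unrIntegers p) p (F - G)) : F = G := by
  haveI := Summit.BirchSwinnertonDyer.Rank1Residual.X2.HidaLimitAlgebra.isDiscreteValuationRing_unrIntegers (p := p)
  exact eq_of_gridMem_sub _ p
    ((IsDiscreteValuationRing.irreducible_iff_uniformizer _).mp
      Summit.BirchSwinnertonDyer.Rank1Residual.X2.HidaLimitAlgebra.irreducible_natCast_p) h

end Instances

end Summit.BirchSwinnertonDyer.BirchSwinnertonDyer.Cruxes.AdditiveSplitIMCInclusionAtThree.DeepGrid

end
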